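import Summits.NavierStokesRegularity.NavierStokesRegularity.Theses.ExtremalTypeIConstant
import Summits.NavierStokesRegularity.NavierStokesRegularity.Theorems.AdaptedFrequencyTangentFlowTransferAncientPressure
import Literature.Analysis.FluidPDE.LerayProfileCalculus
import Literature.Analysis.FluidPDE.TsaiMaximumPrinciple

/-!
# Route `ExtremalTypeIConstant`, support item `HotSpotFirstOrder` (stmt-NavierStokesRegularity-8221)

First-order conditions at the hot spot of an extremal element of the Type-I ancient class in the
Koch–Nadirashvili–Seregin–Šverák Oseen gauge. Let `u` be smooth on `(−∞,0) × ℝ³`, divergence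
free, KNSS-mild between all pairs of negative times, with the temporal Type-I bound
`‖u(t,x)‖ ≤ C/√(−t)`, `C > 0`, and suppose the bound is attained at `(t,x) = (−1,0)`:
`‖u(−1,0)‖ = C`. Then `F(t,x) = (−t)‖u(t,x)‖² ≤ C²` on `t < 0` with equality at the interior
point `(−1,0)`, so

* `∇ₓ‖u(−1,·)‖²(0) = 0` (first-order condition in space, `IsLocalMax.fderiv_eq_zero`);
* `∂ₜ‖u(·,0)‖²(−1) = C²` (first-order condition in time for `t ↦ (−t)‖u(t,0)‖²`);
* `Δₓ‖u(−1,·)‖²(0) ≤ 0` (second-order condition, the tree's `laplacian_nonpos_of_isLocalMax`);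
* the gauge makes `(u,p)` a classical Navier–Stokes solution on `t < 0` for one smooth pressure
  (the tree's `exists_isClassicalNSSolutionOn_Iio_of_isTypeIAncientMild`: Fabes–Jones–Rivière on
  windows, pressures normalised at the origin and patched), and pairing the momentum equation at
  `(−1,0)` with `u(−1,0)` — using `Δ|u|² = 2⟪Δu,u⟫ + 2|∇u|²` (`laplacian_inner_self_eq`) and the
  three conditions above — gives the PRESSURE PUSH `−⟪u,∇p⟫(−1,0) ≥ C²/2 + |∇u(−1,0)|²`.

The minimality clause of the item (extremality of `C` among the constants of nontrivial
elements) is not needed for these conclusions; only attainment at `(−1,0)` is used.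

References: G. Koch, N. Nadirashvili, G. Seregin, V. Šverák, Acta Math. 203 (2009) =
arXiv:0709.3599, §4; G. Seregin, *Lecture Notes on Regularity Theory for the Navier–Stokes
Equations* (2014), §6.3.
-/

noncomputable section

namespace Summit.NavierStokesRegularity.NavierStokesRegularity.Theorems

open MeasureTheory Set Function Filter Topology
open scoped RealInnerProductSpace Laplacian ContDiff
open Literature.Analysis Literature.Analysis.FluidPDE

/-- Time lines of a field jointly smooth on the open slab `(−∞,0) × ℝ³` are differentiable at
every negative time: `s ↦ u(s,x)` has derivative `deriv (u · x) t` at `t < 0` (chain rule with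
`s ↦ (s,x)`). [folklore] -/
theorem hotSpotFirstOrder_hasDerivAt_timeLine
    {u : ℝ → EuclideanSpace ℝ (Fin 3) → EuclideanSpace ℝ (Fin 3)}
    (hsm : ContDiffOn ℝ (⊤ : ℕ∞) (uncurry u) (Iio 0 ×ˢ univ)) {t : ℝ} (ht : t < 0)
    (x : EuclideanSpace ℝ (Fin 3)) :
    HasDerivAt (fun s => u s x) (deriv (fun s => u s x) t) t := by
  have hopen : IsOpen (Iio (0 : ℝ) ×ˢ (univ : Set (EuclideanSpace ℝ (Fin 3)))) :=
    isOpen_Iio.prod isOpen_univ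
  have hct : ContDiffAt ℝ (⊤ : ℕ∞) (uncurry u) (t, x) :=
    hsm.contDiffAt (hopen.mem_nhds ⟨ht, mem_univ _⟩)
  have hd : DifferentiableAt ℝ (uncurry u) (t, x) := hct.differentiableAt (by simp)
  have hline : DifferentiableAt ℝ (fun s : ℝ => ((s, x) : ℝ × EuclideanSpace ℝ (Fin 3))) t :=
    differentiableAt_id.prodMk (differentiableAt_const _)
  have hcomp : DifferentiableAt ℝ (uncurry u ∘ fun s : ℝ => ((s, x) : ℝ × EuclideanSpace ℝ (Fin 3))) t :=
    hd.comp t hline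
  exact hcomp.hasDerivAt

/-- **First-order conditions at the hot spot** (route `ExtremalTypeIConstant`, support item
`HotSpotFirstOrder`, stmt-NavierStokesRegularity-8221): for an element `u` of the Type-I ancient
class `A_C` (`C > 0`) in the KNSS Oseen gauge whose Type-I bound is attained at `(−1,0)`,
`∇ₓ‖u(−1,·)‖²(0) = 0`, `∂ₜ‖u(·,0)‖²(−1) = C²`, `Δₓ‖u(−1,·)‖²(0) ≤ 0`, and for a smooth pressure
`p` making `(u,p)` a classical solution on `t < 0`,
`C²/2 + |∇u(−1,0)|² ≤ −⟪u(−1,0), ∇p(−1,0)⟫` (module docstring). [folklore] -/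
theorem extremalTypeIConstant_hotSpotFirstOrder_proof :
    Summit.NavierStokesRegularity.NavierStokesRegularity.Theses.ExtremalTypeIConstant.HotSpotFirstOrder := by
  rintro C u _hC ⟨hclass, hnorm, -⟩
  have hA : IsTypeIAncientMild C u := isTypeIAncientMild_iff.2 hclass
  obtain ⟨hsm, -, -, hdecay⟩ := hclass
  -- the slice `u(-1, ·)` is smooth
  have hslice : ContDiff ℝ ∞ (u (-1)) :=
    IsSmoothSpaceTimeOn.contDiff_slice (S := Iio 0) (w := u) hsm (show (-1 : ℝ) < 0 by norm_num)
  have hslice2 : ContDiff ℝ 2 (u (-1)) := hslice.of_le (by norm_cast)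
  -- (a), (c): `x ↦ ‖u(-1,x)‖²` has a global maximum at `x = 0`
  have hbound1 : ∀ x, ‖u (-1) x‖ ≤ C := fun x => by
    have h := hdecay (-1) (by norm_num) x
    simpa using h
  have hgmax : IsLocalMax (fun x => ‖u (-1) x‖ ^ 2) 0 :=
    Filter.Eventually.of_forall fun x => by
      show ‖u (-1) x‖ ^ 2 ≤ ‖u (-1) 0‖ ^ 2
      rw [hnorm]
      exact pow_le_pow_left₀ (norm_nonneg _) (hbound1 x) 2
  have ha : fderiv ℝ (fun x => ‖u (-1) x‖ ^ 2) 0 = 0 := hgmax.fderiv_eq_zero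
  have hc : (Δ (fun x => ‖u (-1) x‖ ^ 2)) 0 ≤ 0 :=
    laplacian_nonpos_of_isLocalMax (hslice2.norm_sq ℝ) hgmax
  -- (b): `s ↦ (-s) ‖u(s,0)‖²` has a local maximum at `s = -1`
  have hline := hotSpotFirstOrder_hasDerivAt_timeLine hsm (show (-1 : ℝ) < 0 by norm_num) 0
  have hh : HasDerivAt (fun s => ‖u s 0‖ ^ 2)
      (2 * ⟪u (-1) 0, deriv (fun s => u s 0) (-1)⟫) (-1) := hline.norm_sq
  have hFmax : IsLocalMax (fun s : ℝ => -s * ‖u s 0‖ ^ 2) (-1) := by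
    filter_upwards [Iio_mem_nhds (show (-1 : ℝ) < 0 by norm_num)] with s hs
    have hs' : s < 0 := hs
    have hpos : 0 < -s := neg_pos.2 hs'
    have hsq : ‖u s 0‖ ^ 2 ≤ C ^ 2 / (-s) := by
      have h1 := hdecay s hs' 0
      have h2 : ‖u s 0‖ ^ 2 ≤ (C / Real.sqrt (-s)) ^ 2 :=
        pow_le_pow_left₀ (norm_nonneg _) h1 2
      rwa [div_pow, Real.sq_sqrt hpos.le] at h2
    calc -s * ‖u s 0‖ ^ 2 ≤ -s * (C ^ 2 / (-s)) := mul_le_mul_of_nonneg_left hsq hpos.le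
      _ = C ^ 2 := by
          have hne : s ≠ 0 := hs'.ne
          field_simp
      _ = -(-1) * ‖u (-1) 0‖ ^ 2 := by rw [hnorm]; ring
  have hF : HasDerivAt (fun s : ℝ => -s * ‖u s 0‖ ^ 2)
      (-1 * ‖u (-1) 0‖ ^ 2 + -(-1) * (2 * ⟪u (-1) 0, deriv (fun s => u s 0) (-1)⟫)) (-1) :=
    (hasDerivAt_neg' (-1 : ℝ)).mul hh
  have hzero := hFmax.hasDerivAt_eq_zero hF
  have hUd : 2 * ⟪u (-1) 0, deriv (fun s => u s 0) (-1)⟫ = C ^ 2 := by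
    rw [hnorm] at hzero
    linarith
  -- (d): one pressure on the whole slab
  obtain ⟨p, hp⟩ := exists_isClassicalNSSolutionOn_Iio_of_isTypeIAncientMild hA
  refine ⟨ha, ?_, hc, p, hp, ?_⟩
  · -- (b)
    show deriv (fun s => ‖u s 0‖ ^ 2) (-1) = C ^ 2
    rw [hh.deriv, hUd]
  · -- the pressure push: pair the momentum equation at `(-1, 0)` with `u(-1, 0)`
    have hmom := hp.momentum (-1) (show (-1 : ℝ) < 0 by norm_num) 0
    have htd : timeDerivWithin (Iio 0) u (-1) 0 = deriv (fun s => u s 0) (-1) := by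
      rw [timeDerivWithin_apply, derivWithin_of_mem_nhds (Iio_mem_nhds (by norm_num))]
    rw [htd, convect_apply, one_smul, Pi.zero_apply, Pi.zero_apply, add_zero] at hmom
    -- `⟪u, Du[u]⟫ = ½ D‖u‖²[u] = 0` at the hot spot
    have hUA : ⟪u (-1) 0, fderiv ℝ (u (-1)) 0 (u (-1) 0)⟫ = 0 := by
      have hdiff : DifferentiableAt ℝ (u (-1)) 0 := hslice.differentiable (by simp) 0
      have h1 := hdiff.hasFDerivAt.norm_sq
      have h0 : HasFDerivAt (fun x => ‖u (-1) x‖ ^ 2)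
          (0 : EuclideanSpace ℝ (Fin 3) →L[ℝ] ℝ) 0 := by
        have h := h1.differentiableAt.hasFDerivAt
        rwa [ha] at h
      have heq := h1.unique h0
      have h3 := congrArg (fun L : EuclideanSpace ℝ (Fin 3) →L[ℝ] ℝ => L (u (-1) 0)) heq
      simp only [FunLike.coe_smul, ContinuousLinearMap.coe_comp, Pi.smul_apply,
        Function.comp_apply, innerSL_apply_apply, FunLike.coe_zero, Pi.zero_apply,
        nsmul_eq_mul, Nat.cast_ofNat] at h3
      linarith
    -- `Δ‖u‖² = 2⟪Δu, u⟫ + 2|Du|²` and `Δ‖u‖²(0) ≤ 0`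
    have hlap := laplacian_inner_self_eq hslice2 (0 : EuclideanSpace ℝ (Fin 3))
    have hfun : (fun y => ⟪u (-1) y, u (-1) y⟫) = fun x => ‖u (-1) x‖ ^ 2 :=
      funext fun y => real_inner_self_eq_norm_sq _
    rw [hfun] at hlap
    have hcomm : ⟪(Δ (u (-1))) 0, u (-1) 0⟫ = ⟪u (-1) 0, (Δ (u (-1))) 0⟫ := by
      rw [real_inner_comm]
    have hUL : ⟪u (-1) 0, (Δ (u (-1))) 0⟫ ≤ -frobeniusNormSq (fderiv ℝ (u (-1)) 0) := by
      linarith [hc, hlap, hcomm]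
    -- pair the momentum equation with `u(-1, 0)`
    have key : ⟪u (-1) 0, deriv (fun s => u s 0) (-1)⟫
        + ⟪u (-1) 0, fderiv ℝ (u (-1)) 0 (u (-1) 0)⟫ =
        ⟪u (-1) 0, (Δ (u (-1))) 0⟫ - ⟪u (-1) 0, gradient (p (-1)) 0⟫ := by
      rw [← inner_add_right, ← inner_sub_right, hmom]
    show C ^ 2 / 2 + frobeniusNormSq (fderiv ℝ (u (-1)) 0) ≤ -⟪u (-1) 0, gradient (p (-1)) 0⟫
    linarith [hUd, hUA, hUL, key]

end Summit.NavierStokesRegularity.NavierStokesRegularity.Theorems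

end
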